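import Summits.ValiantsHypothesis.ValiantsHypothesis.Theorems.FifoMatchingNNDivisionHardExactPencilDeadBlocks
import HarnessLib

/-!
# EXACT PENCILS XI — genericity in EDGE FORM with dead blocks (CLAIM α in kernel: `exists_commonMax_of_edgesReadD`, ★★★ `cor_add_bound_of_edgesReadD`), the vertex-pair forms, ★★★ `cor_add_touchOrSparse_bound`, and MECHANISM α at `D = ∅` (`commonMax`, `pairsRead`, sparse differences) (crux `NNDivisionHard`, stmt-ValiantsHypothesis-21181) — `ExactPencil` port part 11/12

Theorems-side port (staged by val-idea-40 g6, C′-census owner per director-valiant R331 (2)(e) / desk #399, for the port hands;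
press as `Theorems/FifoMatchingNNDivisionHardExactPencilPairsRead.lean`, `--kind proof --supports stmt-ValiantsHypothesis-21181 --as helper`; sig-first val-idea-crit-9 g3) of
§12c (second half), §12d and §12e of val-idea-38 g2's crux workfile `Cruxes/NNDivisionHard/ExactPencil38.lean` REV 16 @4e81d1716f6b (sha16 d9f2e288279a0b09, 3 456 l., FROZEN — final from 38 g2, bus 01:14:51Z; critic of record val-idea-crit-9 g2/g3: `CRITIC-wave6.md` FINAL + V#97 §2 «rev 14/15 δ KERNEL VERIFIED»).  Declaration texts VERBATIM (namespace
`…Theorems.FifoMatching.ExactPencil`; one-line docstrings added where the source had none); the 40-g5 tools the source RESTATED are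
DROPPED here and cited BY NAME from the landed ports `…Theorems.FifoMatching.LocatedRows.*` (✓ p680125 … p683387: `T`, `RowFamily`,
`hCOR`, `exactTilted`, `ExactPencilLaw`, `pinnedRows`, `unflat`, `three_pow_le_of_block`, `two_pow_half_mul_le`, `zgen`, `cubePt`, …) and
`…Theorems.FifoMatching.XcDivision` (`udRow`, `udPt`, `udInd`, `udMat`, …), so that C′ stays ONE Theorems declaration
`LocatedRows.ExactPencilLaw`.  Part 11/12 of the port (imports part 10, `…Theorems.FifoMatchingNNDivisionHardExactPencilDeadBlocks`).

* §12c `exists_witnessD`, ★★★ `exists_commonMax_of_edgesReadD` (rev 16, CLAIM α: a NEIGHBOUR structure with a CONE certificate all of whose nonzero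
  EDGE directions are read by a live-face-zero direction ⟹ a tight `W` + ONE common maximiser; two-scale lexicographic maximiser + cone descent),
  ★★ `exists_commonMax_of_pairsReadD` (vertex-pair form, `N = univ`), ★★★ `cor_add_bound_of_edgesReadD`, ★★ `cor_add_bound_of_pairsReadD`,
  ★★★ `cor_add_touchOrSparse_bound` (every nonzero entry of every pairwise vertex difference in a dead column or in a column set of size `< s`);
* §12d ★★ `cor_add_bound_of_commonMax`, `cor_add_decided_of_commonMax` (the case `D = ∅`);
* §12e `exists_commonMax_of_pairsRead`, ★★ `cor_add_bound_of_pairsRead`, ★★★ `cor_add_sparseDiff_bound`, ★★★ `cor_add_sparseDiff_decided`.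

HONEST LABEL: every theorem here is a DECIDED SPECIES / support lemma for the OPEN law C′ = `LocatedRows.ExactPencilLaw`
(`exactTilted.Law`); the crux 21181 `NNDivisionHard`, C′, `allRows.Law` and COR-VIRTUAL are OPEN; C⁺_entry `LocatedPencilLaw` is
REFUTED (✓ p679540).  VP ≠ VNP is NOT proved here or anywhere in this tree.
-/

set_option autoImplicit false

-- the mandated summit-side namespace repeats a component by design (single-problem summit)
set_option linter.dupNamespace false

noncomputable section

open Matrix Finset
open scoped Pointwise

namespace Summit.ValiantsHypothesis.ValiantsHypothesis.Theorems.FifoMatching.ExactPencil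

open Literature.Barriers.PneNP (HasEFOfSize three_pow_le_card_mul_two_pow_of_cover_univ)
open Literature.Combinatorics.Optimization.FixedSizePsdRank
  (corPolytope flat vecOuter flat_dotProduct_le_of_mem_corPolytope flat_dotProduct_vecOuter)
open Summit.ValiantsHypothesis.ValiantsHypothesis.Theorems.FifoMatching.XcDivision
  (udRow udPt udInd udMat ud_data udInd_apply udInd_sq dot_le_of_mem_convexHull flat_dotProduct_flat)
open Summit.ValiantsHypothesis.ValiantsHypothesis.Theorems.FifoMatching.LocatedRows
  (T CorVirtualHardN RowFamily corVirtualHardN_of_law flat_le_box entryTilted allRows LocatedPencilLaw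
    hCOR le_hCOR exists_eq_hCOR flat_le_hCOR hCOR_le_box exactTilted ExactPencilLaw exactTilted_emb_allRows
    corVirtualHardN_of_exactPencilLaw three_pow_le_of_block two_pow_half_mul_le pinnedRows unflat flat_unflat
    pinnedRows_emb_exactTilted corVirtualHardN_of_pinnedRowsLaw zgen cubePt dotProduct_cubePt)

section DeadBlocks

variable {n k : ℕ}

/-- ★ the WITNESS with dead blocks: a nonzero matrix whose nonzero entries lie in dead columns or in a live column set smaller than
every live block is read by an explicit live-face-zero direction (`E_{xy}` for a dead column, `E_{xy} − E_{xy'}` otherwise). -/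
theorem exists_witnessD (β : Fin n → Fin k) (D : Finset (Fin k)) (g : Matrix (Fin n) (Fin n) ℝ) (hg : g ≠ 0)
    (Vs : Finset (Fin n)) (hVs : ∀ x y, g x y ≠ 0 → β y ∈ D ∨ y ∈ Vs) (hs : ∀ i, i ∉ D → Vs.card < bsize β i) :
    ∃ U, faceZeroD β D U ∧ flat U ⬝ᵥ flat g ≠ 0 := by
  classical
  obtain ⟨x, y, hxy⟩ : ∃ x y, g x y ≠ 0 := by
    by_contra h
    push Not at h
    exact hg (Matrix.ext fun x y => by rw [h x y]; rfl)
  by_cases hyD : β y ∈ D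
  · exact ⟨Es x y, Es_faceZeroD β D (Or.inr hyD), by rw [flat_Es_dotProduct_flat]; exact hxy⟩
  · have hyV : y ∈ Vs := (hVs x y hxy).resolve_left hyD
    obtain ⟨y', hy'A, hy'V⟩ : ∃ y' ∈ Finset.univ.filter (fun z => β z = β y), y' ∉ Vs := by
      by_contra h
      push Not at h
      exact absurd (Finset.card_le_card (fun z hz => h z hz)) (not_le.mpr (hs (β y) hyD))
    have hβ : β y' = β y := (Finset.mem_filter.mp hy'A).2
    have h0 : g x y' = 0 := by
      by_contra h
      rcases hVs x y' h with h1 | h1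
      · exact hyD (hβ ▸ h1)
      · exact hy'V h1
    refine ⟨Ed x y y', (Ed_faceZero β hβ.symm).toD D, ?_⟩
    rw [flat_Ed_dotProduct_flat, h0, sub_zero]
    exact hxy

/-- ★★★ **GENERICITY, EDGE FORM with dead blocks** (memo §2g, faces `F_{Z,β}`; the kernel form of CLAIM α).  A NEIGHBOUR STRUCTURE `N` with a
CONE CERTIFICATE (every `q_{j'} − q_j` is a nonnegative combination of the edge directions `q_e − q_j`, `e ∈ N j` — true for the 1-skeleton of any
polytope; for a cube: flip one generator; for `PM(K_n)`: disjoint alternating cycles) and every nonzero EDGE direction read by a live-face-zero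
direction ⇒ a direction tight on the live face (`h_COR = 0`) and ONE passenger point maximising EVERY located row. -/
theorem exists_commonMax_of_edgesReadD (β : Fin n → Fin k) (D : Finset (Fin k)) {ι : Type*} [Fintype ι] [Nonempty ι]
    (Qm : ι → Matrix (Fin n) (Fin n) ℝ) (N : ι → Finset ι)
    (hcone : ∀ j j', ∃ c : ι → ℝ, (∀ e, 0 ≤ c e) ∧ flat (Qm j') - flat (Qm j) = ∑ e ∈ N j, c e • (flat (Qm e) - flat (Qm j)))
    (hw : ∀ j, ∀ e ∈ N j, Qm e ≠ Qm j → ∃ U, faceZeroD β D U ∧ flat U ⬝ᵥ flat (Qm e - Qm j) ≠ 0) :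
    ∃ W : Matrix (Fin n) (Fin n) ℝ, ∃ jstar : ι, (∀ S, Disjoint S D → flat W ⬝ᵥ udPt (bUn β S) = hCOR W) ∧
      ∀ (a : Finset (Fin n)) (j : ι), (udRow a + flat W) ⬝ᵥ flat (Qm j) ≤ (udRow a + flat W) ⬝ᵥ flat (Qm jstar) := by
  classical
  let e := Fintype.equivFin (ι × ι)
  let G : Fin (Fintype.card (ι × ι)) → Matrix (Fin n) (Fin n) ℝ := fun t =>
    if (e.symm t).1 ∈ N (e.symm t).2 then Qm (e.symm t).1 - Qm (e.symm t).2 else 0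
  have hwG : ∀ t, G t ≠ 0 → ∃ U, faceZeroD β D U ∧ flat U ⬝ᵥ flat (G t) ≠ 0 := by
    intro t ht
    by_cases hN : (e.symm t).1 ∈ N (e.symm t).2
    · have hG : G t = Qm (e.symm t).1 - Qm (e.symm t).2 := if_pos hN
      rw [hG] at ht ⊢
      exact hw _ _ hN (fun h => ht (by rw [h, sub_self]))
    · exact absurd (if_neg hN : G t = 0) ht
  obtain ⟨V, hV, hVr⟩ := exists_reads_ne_of_closed (faceZeroD β D) (faceZeroD_zero β D) (fun _ _ h h' => faceZeroD_add h h')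
    (fun c _ h => faceZeroD_smul c h) G hwG Finset.univ
  have hVread : ∀ j', ∀ j ∈ N j', Qm j ≠ Qm j' → flat V ⬝ᵥ flat (Qm j) ≠ flat V ⬝ᵥ flat (Qm j') := by
    intro j' j hjN hne h
    have hG : G (e (j, j')) = Qm j - Qm j' := by
      show (if (e.symm (e (j, j'))).1 ∈ N (e.symm (e (j, j'))).2 then _ else _) = _
      rw [Equiv.symm_apply_apply, if_pos hjN]
    have h1 := hVr (e (j, j')) (Finset.mem_univ _) (by rw [hG]; exact sub_ne_zero.mpr hne)
    apply h1
    rw [hG, LocatedRows.flat_sub', dotProduct_sub, h, sub_self]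
  let w : ι → ℝ := fun j => flat (WD β D) ⬝ᵥ flat (Qm j)
  let v : ι → ℝ := fun j => flat V ⬝ᵥ flat (Qm j)
  let wmax : ℝ := Finset.univ.sup' Finset.univ_nonempty w
  have hwle : ∀ j, w j ≤ wmax := fun j => Finset.le_sup' w (Finset.mem_univ j)
  let Jw : Finset ι := Finset.univ.filter (fun j => w j = wmax)
  have hJw : Jw.Nonempty := by
    obtain ⟨j, -, hj⟩ := Finset.exists_mem_eq_sup' Finset.univ_nonempty w
    exact ⟨j, Finset.mem_filter.mpr ⟨Finset.mem_univ _, hj.symm⟩⟩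
  obtain ⟨jstar, hjJ, hjmax⟩ := Finset.exists_max_image Jw v hJw
  have hwstar : w jstar = wmax := (Finset.mem_filter.mp hjJ).2
  let C : ℝ := ∑ j, ∑ x, ∑ y, |Qm j x y|
  have hCj : ∀ j (a : Finset (Fin n)), |udRow a ⬝ᵥ flat (Qm j)| ≤ C := fun j a =>
    (abs_udRow_dotProduct_flat_le a (Qm j)).trans
      (Finset.single_le_sum (f := fun j => ∑ x, ∑ y, |Qm j x y|)
        (fun j _ => Finset.sum_nonneg fun x _ => Finset.sum_nonneg fun y _ => abs_nonneg _) (Finset.mem_univ j))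
  have hC0 : 0 ≤ C := (abs_nonneg _).trans (hCj (Classical.arbitrary ι) ∅)
  let lam : ℝ := 1 + ∑ j, (if v j = v jstar then 0 else (2 * C + 1) / |v jstar - v j|)
  have hlam_term : ∀ j, 0 ≤ (if v j = v jstar then 0 else (2 * C + 1) / |v jstar - v j|) := fun j => by
    split_ifs
    · exact le_refl _
    · exact div_nonneg (by linarith) (abs_nonneg _)
  have hlam1 : 1 ≤ lam := by
    have := Finset.sum_nonneg fun j (_ : j ∈ Finset.univ) => hlam_term j
    show 1 ≤ 1 + _
    linarith
  have hlam_ge : ∀ j, v j ≠ v jstar → (2 * C + 1) / |v jstar - v j| ≤ lam := by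
    intro j hj
    have h1 := Finset.single_le_sum (f := fun j => if v j = v jstar then 0 else (2 * C + 1) / |v jstar - v j|)
      (fun j _ => hlam_term j) (Finset.mem_univ j)
    simp only [if_neg hj] at h1
    show _ ≤ 1 + _
    linarith
  let V₁ : Matrix (Fin n) (Fin n) ℝ := lam • V
  have hV₁ : faceZeroD β D V₁ := faceZeroD_smul lam hV
  let v₁ : ι → ℝ := fun j => flat V₁ ⬝ᵥ flat (Qm j)
  have hv₁ : ∀ j, v₁ j = lam * v j := fun j => by
    show flat (lam • V) ⬝ᵥ flat (Qm j) = lam * (flat V ⬝ᵥ flat (Qm j))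
    rw [LocatedRows.flat_smul', smul_dotProduct, smul_eq_mul]
  have hgap_v : ∀ j ∈ N jstar, w j = wmax → Qm j ≠ Qm jstar → 2 * C + 1 ≤ v₁ jstar - v₁ j := by
    intro j hjN hj hne
    have hvne : v j ≠ v jstar := hVread jstar j hjN hne
    have hvle : v j ≤ v jstar := hjmax j (Finset.mem_filter.mpr ⟨Finset.mem_univ _, hj⟩)
    have hpos : 0 < v jstar - v j := sub_pos.mpr (lt_of_le_of_ne hvle hvne)
    have h1 : (2 * C + 1) / |v jstar - v j| * |v jstar - v j| ≤ lam * |v jstar - v j| :=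
      mul_le_mul_of_nonneg_right (hlam_ge j hvne) (abs_nonneg _)
    rw [div_mul_cancel₀ _ (ne_of_gt (abs_pos.mpr (ne_of_gt hpos))), abs_of_pos hpos] at h1
    rw [hv₁, hv₁, ← mul_sub]
    exact h1
  let Bv : ℝ := ∑ j, |v₁ j|
  have hBv : ∀ j, |v₁ j| ≤ Bv := fun j =>
    Finset.single_le_sum (f := fun j => |v₁ j|) (fun j _ => abs_nonneg _) (Finset.mem_univ j)
  let B : ℝ := ∑ x, ∑ y, |V₁ x y|
  have hB0 : 0 ≤ B := Finset.sum_nonneg fun x _ => Finset.sum_nonneg fun y _ => abs_nonneg _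
  let μ : ℝ := 1 + B + ∑ j, (if w j = wmax then 0 else (2 * C + 2 * Bv + 1) / (wmax - w j))
  have hμ_term : ∀ j, 0 ≤ (if w j = wmax then 0 else (2 * C + 2 * Bv + 1) / (wmax - w j)) := fun j => by
    split_ifs with h
    · exact le_refl _
    · have : 0 ≤ Bv := (abs_nonneg _).trans (hBv j)
      exact div_nonneg (by linarith) (by linarith [hwle j])
  have hμB : 1 + B ≤ μ := by
    have := Finset.sum_nonneg fun j (_ : j ∈ Finset.univ) => hμ_term j
    show 1 + B ≤ 1 + B + _
    linarith
  have hμ0 : 0 ≤ μ := by linarith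
  have hgap_w : ∀ j, w j ≠ wmax → 2 * C + 2 * Bv + 1 ≤ μ * (wmax - w j) := by
    intro j hj
    have hpos : 0 < wmax - w j := sub_pos.mpr (lt_of_le_of_ne (hwle j) hj)
    have h1 := Finset.single_le_sum (f := fun j => if w j = wmax then 0 else (2 * C + 2 * Bv + 1) / (wmax - w j))
      (fun j _ => hμ_term j) (Finset.mem_univ j)
    simp only [if_neg hj] at h1
    have h2 : (2 * C + 2 * Bv + 1) / (wmax - w j) ≤ μ := by show _ ≤ 1 + B + _; linarith
    have h3 := mul_le_mul_of_nonneg_right h2 (le_of_lt hpos)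
    rwa [div_mul_cancel₀ _ (ne_of_gt hpos)] at h3
  let W : Matrix (Fin n) (Fin n) ℝ := μ • WD β D + V₁
  have hWread : ∀ b, flat W ⬝ᵥ udPt b = μ * (flat (WD β D) ⬝ᵥ udPt b) + flat V₁ ⬝ᵥ udPt b := fun b => by
    show flat (μ • WD β D + V₁) ⬝ᵥ udPt b = _
    rw [LocatedRows.flat_add', LocatedRows.flat_smul', add_dotProduct, smul_dotProduct, smul_eq_mul]
  have hWS : ∀ S, Disjoint S D → flat W ⬝ᵥ udPt (bUn β S) = 0 := fun S hS => by
    rw [hWread, WD_dotProduct_bUn β hS, hV₁ S hS, mul_zero, add_zero]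
  have hWle : ∀ b, flat W ⬝ᵥ udPt b ≤ 0 := by
    intro b
    rcases WD_face_or_le_neg_one β D b with ⟨S, hS, rfl⟩ | h1
    · rw [hWS S hS]
    · rw [hWread]
      have h2 : flat V₁ ⬝ᵥ udPt b ≤ B := (le_abs_self _).trans (abs_flat_dotProduct_udPt_le V₁ b)
      have h3 : μ * (flat (WD β D) ⬝ᵥ udPt b) ≤ μ * (-1) := mul_le_mul_of_nonneg_left h1 hμ0
      linarith
  have hCOR_W : hCOR W = 0 :=
    le_antisymm (Finset.sup'_le _ _ fun b _ => hWle b)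
      (by have h := le_hCOR W (bUn β ∅); rwa [hWS ∅ (Finset.disjoint_empty_left D)] at h)
  refine ⟨W, jstar, fun S hS => by rw [hWS S hS, hCOR_W], fun a j => ?_⟩
  have hscore : ∀ j, (udRow a + flat W) ⬝ᵥ flat (Qm j) = udRow a ⬝ᵥ flat (Qm j) + (μ * w j + v₁ j) := fun j => by
    show (udRow a + flat (μ • WD β D + V₁)) ⬝ᵥ flat (Qm j) = _
    rw [add_dotProduct, LocatedRows.flat_add', LocatedRows.flat_smul', add_dotProduct, smul_dotProduct, smul_eq_mul]
  -- the NEIGHBOURS of `jstar` lose against `jstar` on every located row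
  have hnb : ∀ j ∈ N jstar, (udRow a + flat W) ⬝ᵥ flat (Qm j) ≤ (udRow a + flat W) ⬝ᵥ flat (Qm jstar) := by
    intro j hjN
    rw [hscore, hscore, hwstar]
    have ha1 := abs_le.mp (hCj j a)
    have ha2 := abs_le.mp (hCj jstar a)
    by_cases hj : w j = wmax
    · rw [hj]
      by_cases hne : Qm j = Qm jstar
      · have hv : v₁ j = v₁ jstar := by
          show flat V₁ ⬝ᵥ flat (Qm j) = flat V₁ ⬝ᵥ flat (Qm jstar)
          rw [hne]
        rw [hne, hv]
      · have := hgap_v j hjN hj hne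
        linarith
    · have h1 := hgap_w j hj
      have h2 := abs_le.mp (hBv j)
      have h3 := abs_le.mp (hBv jstar)
      nlinarith [mul_sub μ wmax (w j)]
  -- every other point is `jstar` plus a nonnegative combination of edge directions at `jstar` (cone certificate)
  obtain ⟨c, hc0, hdec⟩ := hcone jstar j
  have hsub : (udRow a + flat W) ⬝ᵥ flat (Qm j) - (udRow a + flat W) ⬝ᵥ flat (Qm jstar) =
      ∑ e ∈ N jstar, c e * ((udRow a + flat W) ⬝ᵥ flat (Qm e) - (udRow a + flat W) ⬝ᵥ flat (Qm jstar)) := by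
    rw [← dotProduct_sub, hdec, dotProduct_sum]
    refine Finset.sum_congr rfl fun e _ => ?_
    rw [dotProduct_smul, smul_eq_mul, dotProduct_sub]
  have : (udRow a + flat W) ⬝ᵥ flat (Qm j) - (udRow a + flat W) ⬝ᵥ flat (Qm jstar) ≤ 0 := by
    rw [hsub]
    exact Finset.sum_nonpos fun e he => mul_nonpos_of_nonneg_of_nonpos (hc0 e) (by linarith [hnb e he])
  linarith

/-- ★★ the VERTEX-PAIR form (every pair a neighbour): every nonzero pairwise difference read ⇒ tight `W` + common maximiser. -/
theorem exists_commonMax_of_pairsReadD (β : Fin n → Fin k) (D : Finset (Fin k)) {ι : Type*} [Fintype ι] [Nonempty ι]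
    (Qm : ι → Matrix (Fin n) (Fin n) ℝ)
    (hw : ∀ j j', Qm j ≠ Qm j' → ∃ U, faceZeroD β D U ∧ flat U ⬝ᵥ flat (Qm j - Qm j') ≠ 0) :
    ∃ W : Matrix (Fin n) (Fin n) ℝ, ∃ jstar : ι, (∀ S, Disjoint S D → flat W ⬝ᵥ udPt (bUn β S) = hCOR W) ∧
      ∀ (a : Finset (Fin n)) (j : ι), (udRow a + flat W) ⬝ᵥ flat (Qm j) ≤ (udRow a + flat W) ⬝ᵥ flat (Qm jstar) := by
  classical
  refine exists_commonMax_of_edgesReadD β D Qm (fun _ => Finset.univ) (fun j j' => ⟨fun e => if e = j' then 1 else 0,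
    fun e => by dsimp only; split_ifs <;> norm_num, ?_⟩) (fun j e _ hne => hw e j hne)
  have h : ∀ e ∈ (Finset.univ : Finset ι), (fun e => if e = j' then (1 : ℝ) else 0) e • (flat (Qm e) - flat (Qm j)) =
      if e = j' then flat (Qm e) - flat (Qm j) else 0 := fun e _ => by
    dsimp only
    split_ifs
    · rw [one_smul]
    · rw [zero_smul]
  rw [Finset.sum_congr rfl h, Finset.sum_ite_eq' Finset.univ j', if_pos (Finset.mem_univ _)]

/-- ★★★ **EDGE FORM, DECIDED**: a cone-certified neighbour structure all of whose nonzero edge directions are read by the live face. -/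
theorem cor_add_bound_of_edgesReadD {β : Fin n → Fin k} {σ : Fin k → Fin n} (hβσ : ∀ i, β (σ i) = i) (D : Finset (Fin k))
    {ι : Type*} [Fintype ι] [Nonempty ι] (Qm : ι → Matrix (Fin n) (Fin n) ℝ) (N : ι → Finset ι)
    (hcone : ∀ j j', ∃ c : ι → ℝ, (∀ e, 0 ≤ c e) ∧ flat (Qm j') - flat (Qm j) = ∑ e ∈ N j, c e • (flat (Qm e) - flat (Qm j)))
    (hw : ∀ j, ∀ e ∈ N j, Qm e ≠ Qm j → ∃ U, faceZeroD β D U ∧ flat U ⬝ᵥ flat (Qm e - Qm j) ≠ 0) (r : ℕ)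
    (hEF : HasEFOfSize (corPolytope n + convexHull ℝ (Set.range (fun j => flat (Qm j)))) r) :
    3 ^ (k - D.card) ≤ (r + 1) * 2 ^ (k - D.card) := by
  obtain ⟨W, jstar, ht, hmax⟩ := exists_commonMax_of_edgesReadD β D Qm N hcone hw
  exact cor_add_bound_of_commonMaxD hβσ D (fun j => flat (Qm j)) W ht jstar hmax r hEF

/-- ★★★ **DECIDED WITH A FORCED-OUT SET**: every passenger whose nonzero pairwise vertex differences are read by the live face. -/
theorem cor_add_bound_of_pairsReadD {β : Fin n → Fin k} {σ : Fin k → Fin n} (hβσ : ∀ i, β (σ i) = i) (D : Finset (Fin k))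
    {ι : Type*} [Fintype ι] [Nonempty ι] (Qm : ι → Matrix (Fin n) (Fin n) ℝ)
    (hw : ∀ j j', Qm j ≠ Qm j' → ∃ U, faceZeroD β D U ∧ flat U ⬝ᵥ flat (Qm j - Qm j') ≠ 0) (r : ℕ)
    (hEF : HasEFOfSize (corPolytope n + convexHull ℝ (Set.range (fun j => flat (Qm j)))) r) :
    3 ^ (k - D.card) ≤ (r + 1) * 2 ^ (k - D.card) := by
  obtain ⟨W, jstar, ht, hmax⟩ := exists_commonMax_of_pairsReadD β D Qm hw
  exact cor_add_bound_of_commonMaxD hβσ D (fun j => flat (Qm j)) W ht jstar hmax r hEF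

/-- ★★★ **TOUCH-Z-OR-SPARSE**: every nonzero entry of every pairwise difference in a DEAD column or in a live column set smaller than every
live block ⇒ decided with the `k − |D|` live blocks. -/
theorem cor_add_touchOrSparse_bound {β : Fin n → Fin k} {σ : Fin k → Fin n} (hβσ : ∀ i, β (σ i) = i) (D : Finset (Fin k))
    {ι : Type*} [Fintype ι] [Nonempty ι] (Qm : ι → Matrix (Fin n) (Fin n) ℝ) (Vs : ι → ι → Finset (Fin n))
    (hG : ∀ j j' x y, (Qm j - Qm j') x y ≠ 0 → β y ∈ D ∨ y ∈ Vs j j')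
    (hs : ∀ j j' i, i ∉ D → (Vs j j').card < bsize β i) (r : ℕ)
    (hEF : HasEFOfSize (corPolytope n + convexHull ℝ (Set.range (fun j => flat (Qm j)))) r) :
    3 ^ (k - D.card) ≤ (r + 1) * 2 ^ (k - D.card) :=
  cor_add_bound_of_pairsReadD hβσ D Qm
    (fun j j' hne => exists_witnessD β D _ (sub_ne_zero.mpr hne) (Vs j j') (hG j j') (hs j j')) r hEF

end DeadBlocks

/-! ### §12d MECHANISM α — the ENGINE in kernel (the case `D = ∅` of §12c): ONE passenger point maximising EVERY located row gives the block (memo §2g;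
the genericity half «no edge direction in dir(F) ⇒ such a point and direction exist» is paper) -/

section CommonMax

variable {n k : ℕ}

/-- ★★ **TOP LAW, budget-free, ANY passenger**: if a direction `W` is tight on the together face of `β` and a single passenger point
`q jstar` maximises every located row `udRow a + W` over the passenger family `q`, then every EF of `COR(n) + conv(range q)` has size
`r` with `3^k ≤ (r+1)·2^k`.  (`cor_add_cube_bound_of_pinning` is the case `q = cubePt Q₀ G`, `jstar = Hpin W G`.) -/
theorem cor_add_bound_of_commonMax {β : Fin n → Fin k} {σ : Fin k → Fin n} (hβσ : ∀ i, β (σ i) = i)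
    {ι : Type*} [Fintype ι] (q : ι → (Fin (n * n) → ℝ)) (W : Matrix (Fin n) (Fin n) ℝ)
    (htight : ∀ S : Finset (Fin k), flat W ⬝ᵥ udPt (bUn β S) = hCOR W) (jstar : ι)
    (hmax : ∀ (a : Finset (Fin n)) (j : ι), (udRow a + flat W) ⬝ᵥ q j ≤ (udRow a + flat W) ⬝ᵥ q jstar) (r : ℕ)
    (hEF : HasEFOfSize (corPolytope n + convexHull ℝ (Set.range q)) r) :
    3 ^ k ≤ (r + 1) * 2 ^ k := by
  simpa using cor_add_bound_of_commonMaxD hβσ ∅ q W (fun S _ => htight S) jstar hmax r hEF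

/-- the same with the standard blocks: a common maximiser for a face-tight direction decides the passenger, eventually in `n`,
for every fixed block size `s` (the rate `T_lt_of_block_div`). -/
theorem cor_add_decided_of_commonMax (s c : ℕ) (hs : 0 < s) : ∃ n₀ : ℕ, ∀ n ≥ n₀, ∀ (hns : s ≤ n) {ι : Type} [Fintype ι]
    (q : ι → (Fin (n * n) → ℝ)) (W : Matrix (Fin n) (Fin n) ℝ),
    (∀ S : Finset (Fin (n / s)), flat W ⬝ᵥ udPt (bUn (βstd hs hns) S) = hCOR W) →
    ∀ jstar : ι, (∀ (a : Finset (Fin n)) (j : ι), (udRow a + flat W) ⬝ᵥ q j ≤ (udRow a + flat W) ⬝ᵥ q jstar) →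
    ∀ r : ℕ, HasEFOfSize (corPolytope n + convexHull ℝ (Set.range q)) r → T c n < r := by
  obtain ⟨n₀, hn₀⟩ := T_lt_of_block_div s hs c
  refine ⟨n₀, fun n hn hns ι _ q W htight jstar hmax r hEF => hn₀ n hn r ?_⟩
  exact cor_add_bound_of_commonMax (βstd_σstd hs hns) q W htight jstar hmax r hEF

end CommonMax

/-! ### §12e MECHANISM α for passengers whose VERTEX DIFFERENCES are read by the face-zero directions (kernel: the vertex-pair
version of the genericity lemma of memo §2g) — a common maximiser EXISTS, hence every such passenger is decided -/

section PairsRead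

variable {n k : ℕ}

/-- ★★ **GENERICITY, vertex-pair version** (the case `D = ∅` of `exists_commonMax_of_pairsReadD`). -/
theorem exists_commonMax_of_pairsRead (β : Fin n → Fin k) {ι : Type*} [Fintype ι] [Nonempty ι]
    (Qm : ι → Matrix (Fin n) (Fin n) ℝ)
    (hw : ∀ j j', Qm j ≠ Qm j' → ∃ U, faceZero β U ∧ flat U ⬝ᵥ flat (Qm j - Qm j') ≠ 0) :
    ∃ W : Matrix (Fin n) (Fin n) ℝ, ∃ jstar : ι, (∀ S, flat W ⬝ᵥ udPt (bUn β S) = hCOR W) ∧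
      ∀ (a : Finset (Fin n)) (j : ι), (udRow a + flat W) ⬝ᵥ flat (Qm j) ≤ (udRow a + flat W) ⬝ᵥ flat (Qm jstar) := by
  obtain ⟨W, jstar, ht, hmax⟩ := exists_commonMax_of_pairsReadD β ∅ Qm
    (fun j j' hne => by obtain ⟨U, hU, hr⟩ := hw j j' hne; exact ⟨U, hU.toD ∅, hr⟩)
  exact ⟨W, jstar, fun S => ht S (Finset.disjoint_empty_right S), hmax⟩

/-- ★★★ **EVERY PASSENGER WHOSE VERTEX DIFFERENCES ARE READ BY THE FACE IS DECIDED** (top law, budget-free, any shape). -/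
theorem cor_add_bound_of_pairsRead {β : Fin n → Fin k} {σ : Fin k → Fin n} (hβσ : ∀ i, β (σ i) = i)
    {ι : Type*} [Fintype ι] [Nonempty ι] (Qm : ι → Matrix (Fin n) (Fin n) ℝ)
    (hw : ∀ j j', Qm j ≠ Qm j' → ∃ U, faceZero β U ∧ flat U ⬝ᵥ flat (Qm j - Qm j') ≠ 0) (r : ℕ)
    (hEF : HasEFOfSize (corPolytope n + convexHull ℝ (Set.range (fun j => flat (Qm j)))) r) :
    3 ^ k ≤ (r + 1) * 2 ^ k := by
  obtain ⟨W, jstar, ht, hmax⟩ := exists_commonMax_of_pairsRead β Qm hw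
  exact cor_add_bound_of_commonMax hβσ (fun j => flat (Qm j)) W ht jstar hmax r hEF

/-- ★★★ **SPARSE DIFFERENCES**: pairwise differences with column support smaller than every block ⇒ `3^k ≤ (r+1)·2^k`. -/
theorem cor_add_sparseDiff_bound {β : Fin n → Fin k} {σ : Fin k → Fin n} (hβσ : ∀ i, β (σ i) = i)
    {ι : Type*} [Fintype ι] [Nonempty ι] (Qm : ι → Matrix (Fin n) (Fin n) ℝ) (Vs : ι → ι → Finset (Fin n))
    (hG : ∀ j j' x y, (Qm j - Qm j') x y ≠ 0 → y ∈ Vs j j') (hs : ∀ j j' i, (Vs j j').card < bsize β i) (r : ℕ)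
    (hEF : HasEFOfSize (corPolytope n + convexHull ℝ (Set.range (fun j => flat (Qm j)))) r) :
    3 ^ k ≤ (r + 1) * 2 ^ k := by
  classical
  refine cor_add_bound_of_pairsRead hβσ Qm (fun j j' hne => ?_) r hEF
  let e := Fintype.equivFin (ι × ι)
  have h := exists_witness_of_sparse β (fun t : Fin (Fintype.card (ι × ι)) => Qm (e.symm t).1 - Qm (e.symm t).2)
    (fun t => Vs (e.symm t).1 (e.symm t).2) (fun t x y hxy => hG _ _ x y hxy) (fun t i => hs _ _ i) (e (j, j'))
  simp only [e, Equiv.symm_apply_apply] at h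
  exact h (sub_ne_zero.mpr hne)

/-- the rate: for every fixed column-support bound `s`, eventually in `n`, every passenger whose pairwise vertex differences have
nonzero columns in sets of size `< s` satisfies `xc(COR(n) + passenger) > T c n`. -/
theorem cor_add_sparseDiff_decided (s c : ℕ) (hs : 0 < s) : ∃ n₀ : ℕ, ∀ n ≥ n₀, ∀ {ι : Type} [Fintype ι] [Nonempty ι]
    (Qm : ι → Matrix (Fin n) (Fin n) ℝ) (Vs : ι → ι → Finset (Fin n)),
    (∀ j j' x y, (Qm j - Qm j') x y ≠ 0 → y ∈ Vs j j') → (∀ j j', (Vs j j').card < s) → ∀ r : ℕ,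
    HasEFOfSize (corPolytope n + convexHull ℝ (Set.range (fun j => flat (Qm j)))) r → T c n < r := by
  obtain ⟨n₀, hn₀⟩ := T_lt_of_block_div s hs c
  refine ⟨max n₀ s, fun n hn ι _ _ Qm Vs hG hVs r hEF => hn₀ n (le_of_max_le_left hn) r ?_⟩
  have hns : s ≤ n := le_of_max_le_right hn
  exact cor_add_sparseDiff_bound (βstd_σstd hs hns) Qm Vs hG (fun j j' i => lt_of_lt_of_le (hVs j j') (le_bsize_βstd hs hns i)) r hEF

end PairsRead

end Summit.ValiantsHypothesis.ValiantsHypothesis.Theorems.FifoMatching.ExactPencil
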